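import Summits.ValiantsHypothesis.ValiantsHypothesis.Theorems.LacunarySymmetroidMatrixDescartesCensusTropicalKLawSlopes

/-!
# Route «KPlusLogSqLaw», crux `TropicalB` (stmt-ValiantsHypothesis-19771) — the EXCHANGE SECTOR, part 1:
# the stage lemma, and DOMINANCE MONOTONICITY of class profiles under Murota's exchange axiom

HONEST FRAMING.  Helper toward the registered stubs `stub_tropThin` / `stub_tropFat` of `Cruxes/TropicalB/Lines/birth.lean` (crux
`Summit.ValiantsHypothesis.ValiantsHypothesis.Theses.KPlusLogSqLaw.TropicalB`, item stmt-ValiantsHypothesis-19771, route KPlusLogSqLaw,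
DRAFT; cell `pub-symmetroid`, seat val-sym-trop-p1 g9, 2026-08-27; `--supports … --as helper`).  A SECTOR theorem (its hypothesis is a
property of the design's value function); it proves no part of the stubs for general designs and asserts nothing about `TropicalB` in its
window, `WeakLifting`, DoorA26 / DoorA34, `MatrixDescartes` (stmt-ValiantsHypothesis-18050) or VP ≠ VNP.

THE READING.  Along the line `θ ↦ θ·d` the crux's envelope is `E(θ) = max_{n⃗} (θ·⟨d, n⃗⟩ + g(n⃗))`, where
`g(n⃗) = max {−V(p) : p present, class profile of p = n⃗}` is the COLOURED-MATCHING VALUE FUNCTION of the design on the simplex slice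
`{n⃗ ∈ ℕ^K : Σ_l n_l = m}` (`E` is the tropical determinant of the matrix pencil `⊕_l (θ·d_l) ⊙ A_l` read along a line).  If `g` satisfies
Murota's exchange axiom (M-EXC) — for profiles `x, y` in the domain and a class `i` with `x_i > y_i` there is `j` with `x_j < y_j` and
`g(x) + g(y) ≤ g(x − e_i + e_j) + g(y + e_i − e_j)`; i.e. `g` is M-concave, «gross substitutes» among slope classes — then between the unique
optimum `p` at `θ` and the unique optimum `q` at `θ' > θ` the class profile moves UP IN THE DOMINANCE ORDER: every upper class count
`#{b : λ_b ≥ c}` weakly increases (`upper_le_of_dominant`; exponents sorted, `Monotone d`, which `…TropicalBRelabel` arranges).  Part 2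
(`…TropicalBExchangeSector`) turns this into the LINEAR law `n ≤ m·(K−1)` for every dominant chain of such a design, at every format and for
all exponent vectors — so every super-linear dominant chain the cell knows (SHIFT-THREE's `C(m+2,2) − 1` terms at `K = 3`, the diamond
family, the staircase) lives on a FAILURE of the exchange axiom, i.e. on a complementarity between slope classes: beyond the
arithmetic-progression row, `TropicalB`'s content is exactly there.

THE ARGUMENT (no genericity, no scale separation, no support hypothesis).  For sorted exponents write
`θ'·d_l = θ·d_l + (θ'−θ)·d₀ + Σ_{1 ≤ c ≤ l} (θ'−θ)(d_c − d_{c−1})`, i.e. `θ'·d = θ·d + const + Σ_c t_c·𝟙[· ≥ c]` with `t_c ≥ 0`, and add the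
thresholds one at a time.  STAGE LEMMA (`stage`): if `q` maximises the class-weighted value `Σ_b W''(λ_b) − V` among present terms, where
`W'' = W + t·𝟙[· ≥ c]` and `t ≥ 0`, then some maximiser `p` of the `W`-value has `cnt_l(p) ≤ cnt_l(q)` for `l ≥ c` and `cnt_l(q) ≤ cnt_l(p)`
for `l < c` — take a `W`-maximiser `ℓ¹`-closest to `q` in class counts; a violation plus (M-EXC) produces a `W`-maximiser two units closer
(`dist_step`).  One stage moves all upper counts the right way (`upper_le_of_stage`); descending from `q` (the `θ'·d`-maximiser) through
the thresholds ends at the `θ·d`-maximiser, which is `p` by uniqueness (`upper_le_of_dominant`).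

The axiom is stated at TERM LEVEL and inline (hypothesis `hex`; no definition is introduced): for present `p, q` and a class `i`
over-represented in `p` there are an under-represented class `j` and present terms `p'` = «`p` with one `i` traded for a `j`», `q'` = «`q`
with one `j` traded for an `i`» (as class COUNTS; the rows are unconstrained) with `V(p') + V(q') ≤ V(p) + V(q)`.
References: K. Murota, Discrete Convex Analysis (SIAM 2003), Ch. 6 (the exchange axiom (M-EXC)); the monotone comparative statics is the
gross-substitutes phenomenon of discrete convex analysis; the kernel argument is this file's.
-/

set_option linter.dupNamespace false
set_option autoImplicit false

namespace Summit.ValiantsHypothesis.ValiantsHypothesis.Theorems.KPlusLogSqLaw.ExchangeSector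

open Summit.ValiantsHypothesis.ValiantsHypothesis.Theorems.MatrixDescartes.Negative
open Summit.ValiantsHypothesis.ValiantsHypothesis.Theorems.LacunarySymmetroidMatrixDescartes
open Summit.ValiantsHypothesis.ValiantsHypothesis.Theorems.LacunarySymmetroidMatrixDescartes.TropicalCensus
open scoped BigOperators
open Finset

variable {m K : ℕ}

/-! ## 1. Class counts and class-weighted sums -/

/-- fibrewise rewriting: a sum of a class function over the columns of a term is the count-weighted sum over classes.
[folklore] -/
theorem sum_class_eq (X : Fin K → ℤ) (r : Fin m → Fin K) :
    ∑ b, X (r b) = ∑ l, ((univ.filter fun b => r b = l).card : ℤ) * X l := by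
  rw [← sum_fiberwise_of_maps_to (s := (univ : Finset (Fin m))) (t := (univ : Finset (Fin K)))
    (g := r) (fun b _ => mem_univ _) (fun b => X (r b))]
  refine sum_congr rfl fun l _ => ?_
  rw [sum_congr rfl (fun b hb => by rw [(mem_filter.mp hb).2] : ∀ b ∈ univ.filter (fun b => r b = l),
    X (r b) = X l), sum_const, nsmul_eq_mul]

/-- one unit of class `a` traded for one unit of class `b` shifts every class-weighted sum by `X b − X a`
(additive form). [folklore] -/
theorem sum_class_shift (X : Fin K → ℤ) (r r' : Fin m → Fin K) (a b : Fin K)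
    (h : ∀ l, (univ.filter fun i => r' i = l).card + (if l = a then 1 else 0) =
      (univ.filter fun i => r i = l).card + (if l = b then 1 else 0)) :
    (∑ i, X (r' i)) + X a = (∑ i, X (r i)) + X b := by
  rw [sum_class_eq X r', sum_class_eq X r]
  have hz : ∀ l, ((univ.filter fun i => r' i = l).card : ℤ) * X l + (if l = a then X l else 0) =
      ((univ.filter fun i => r i = l).card : ℤ) * X l + (if l = b then X l else 0) := by
    intro l
    have hl := h l
    have hl' : ((univ.filter fun i => r' i = l).card : ℤ) + (if l = a then 1 else 0) =
        ((univ.filter fun i => r i = l).card : ℤ) + (if l = b then 1 else 0) := by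
      split_ifs at hl ⊢ <;> omega
    have := congrArg (fun z => z * X l) hl'
    simp only [add_mul] at this
    split_ifs at this ⊢ <;> simp only [one_mul, zero_mul] at this <;> linarith
  have hsum := sum_congr rfl fun l (_ : l ∈ (univ : Finset (Fin K))) => hz l
  rw [sum_add_distrib, sum_add_distrib, sum_ite_eq' univ a, sum_ite_eq' univ b] at hsum
  simpa using hsum

/-- the `ℓ¹`-distance bookkeeping of one exchange step towards a target count vector `g`: trading a unit of an
over-represented class `a` for a unit of an under-represented class `b` brings the count vector two units closer.
[folklore] -/
theorem dist_step (f g f' : Fin K → ℕ) (a b : Fin K)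
    (h : ∀ l, f' l + (if l = a then 1 else 0) = f l + (if l = b then 1 else 0))
    (ha : g a < f a) (hb : f b < g b) :
    (∑ l, |(f' l : ℤ) - g l|) + 2 = ∑ l, |(f l : ℤ) - g l| := by
  have hab : a ≠ b := by rintro rfl; omega
  have hz : ∀ l, |(f' l : ℤ) - g l| + ((if l = a then (1:ℤ) else 0) + (if l = b then (1:ℤ) else 0)) =
      |(f l : ℤ) - g l| := by
    intro l
    have hl := h l
    by_cases hla : l = a
    · subst hla
      rw [if_pos rfl, if_neg hab] at hl
      rw [if_pos rfl, if_neg hab]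
      have e : (f' l : ℤ) = f l - 1 := by omega
      rw [e, abs_of_nonneg (by omega), abs_of_nonneg (by omega)]
      ring
    · by_cases hlb : l = b
      · subst hlb
        rw [if_neg hla, if_pos rfl] at hl
        rw [if_neg hla, if_pos rfl]
        have e : (f' l : ℤ) = f l + 1 := by omega
        rw [e, abs_of_nonpos (by omega), abs_of_nonpos (by omega)]
        ring
      · rw [if_neg hla, if_neg hlb] at hl
        rw [if_neg hla, if_neg hlb]
        have e : (f' l : ℤ) = f l := by omega
        rw [e]; ring
  have hsum := sum_congr rfl fun l (_ : l ∈ (univ : Finset (Fin K))) => hz l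
  rw [sum_add_distrib, sum_add_distrib, sum_ite_eq' univ a, sum_ite_eq' univ b] at hsum
  simp only [mem_univ, if_true] at hsum
  linarith

/-! ## 2. The stage lemma (one threshold of the class-weight vector at a time) -/

/-- **STAGE LEMMA.**  Let the design `(v, ε)` satisfy the TERM-LEVEL EXCHANGE AXIOM `hex` (Murota's (M-EXC) for the
coloured-matching value function `n⃗ ↦ max {−V(p) : p present, class counts of p = n⃗}`, unrolled to terms).  Let `W` be any
class-weight vector, `t ≥ 0`, and `W'' = W + t·𝟙[class index ≥ c]`.  If the present term `q` maximises the `W''`-weight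
`Σ_b W''(λ_b) − V` among present terms, then some present term `p` maximises the `W`-weight and is dominated by `q` on the upper
classes and dominates it on the lower ones: `cnt_l(p) ≤ cnt_l(q)` for `l ≥ c`, `cnt_l(q) ≤ cnt_l(p)` for `l < c`.
Proof: take a `W`-maximiser `ℓ¹`-closest to `q` in class counts; a violation plus (M-EXC) produces a `W`-maximiser two units
closer.  [this file; the exchange axiom is Murota's, Discrete Convex Analysis (2003) §6] -/
theorem stage (v ε : Fin m → Fin m → Fin K → ℤ)
    (hex : ∀ p q : Equiv.Perm (Fin m) × (Fin m → Fin K), termSign ε p ≠ 0 → termSign ε q ≠ 0 →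
      ∀ i : Fin K, (univ.filter fun b => q.2 b = i).card < (univ.filter fun b => p.2 b = i).card →
        ∃ j : Fin K, (univ.filter fun b => p.2 b = j).card < (univ.filter fun b => q.2 b = j).card ∧
          ∃ p' q' : Equiv.Perm (Fin m) × (Fin m → Fin K), termSign ε p' ≠ 0 ∧ termSign ε q' ≠ 0 ∧
            (∀ l, (univ.filter fun b => p'.2 b = l).card + (if l = i then 1 else 0) =
              (univ.filter fun b => p.2 b = l).card + (if l = j then 1 else 0)) ∧
            (∀ l, (univ.filter fun b => q'.2 b = l).card + (if l = j then 1 else 0) =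
              (univ.filter fun b => q.2 b = l).card + (if l = i then 1 else 0)) ∧
            (∑ b, v (p'.1 b) b (p'.2 b)) + (∑ b, v (q'.1 b) b (q'.2 b)) ≤
              (∑ b, v (p.1 b) b (p.2 b)) + (∑ b, v (q.1 b) b (q.2 b)))
    (W : Fin K → ℤ) (t : ℤ) (ht : 0 ≤ t) (c : ℕ)
    (q : Equiv.Perm (Fin m) × (Fin m → Fin K)) (hq : termSign ε q ≠ 0)
    (hqmax : ∀ r : Equiv.Perm (Fin m) × (Fin m → Fin K), termSign ε r ≠ 0 →
      (∑ b, (W (r.2 b) + if c ≤ (r.2 b : ℕ) then t else 0)) - ∑ b, v (r.1 b) b (r.2 b) ≤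
      (∑ b, (W (q.2 b) + if c ≤ (q.2 b : ℕ) then t else 0)) - ∑ b, v (q.1 b) b (q.2 b)) :
    ∃ p : Equiv.Perm (Fin m) × (Fin m → Fin K), termSign ε p ≠ 0 ∧
      (∀ r : Equiv.Perm (Fin m) × (Fin m → Fin K), termSign ε r ≠ 0 →
        (∑ b, W (r.2 b)) - ∑ b, v (r.1 b) b (r.2 b) ≤ (∑ b, W (p.2 b)) - ∑ b, v (p.1 b) b (p.2 b)) ∧
      (∀ l : Fin K, c ≤ (l : ℕ) →
        (univ.filter fun b => p.2 b = l).card ≤ (univ.filter fun b => q.2 b = l).card) ∧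
      (∀ l : Fin K, (l : ℕ) < c →
        (univ.filter fun b => q.2 b = l).card ≤ (univ.filter fun b => p.2 b = l).card) := by
  classical
  -- class-weighted value and the perturbed weight vector
  set cw : (Fin K → ℤ) → (Equiv.Perm (Fin m) × (Fin m → Fin K)) → ℤ :=
    fun X r => (∑ b, X (r.2 b)) - ∑ b, v (r.1 b) b (r.2 b) with hcw
  set W'' : Fin K → ℤ := fun l => W l + if c ≤ (l : ℕ) then t else 0 with hW''
  have hqmax' : ∀ r, termSign ε r ≠ 0 → cw W'' r ≤ cw W'' q := fun r hr => by
    simpa only [hcw, hW''] using hqmax r hr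
  -- a `W`-maximal present term exists
  have hpres : (univ.filter fun r : Equiv.Perm (Fin m) × (Fin m → Fin K) => termSign ε r ≠ 0).Nonempty :=
    ⟨q, by simp [hq]⟩
  obtain ⟨r₀, hr₀, hr₀max⟩ := exists_max_image _ (cw W) hpres
  -- among the `W`-maximal present terms take one closest to `q` in class counts
  set S := univ.filter fun r : Equiv.Perm (Fin m) × (Fin m → Fin K) =>
    termSign ε r ≠ 0 ∧ ∀ r', termSign ε r' ≠ 0 → cw W r' ≤ cw W r with hS
  have hSne : S.Nonempty := by
    refine ⟨r₀, ?_⟩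
    rw [hS, mem_filter]
    exact ⟨mem_univ _, (mem_filter.mp hr₀).2, fun r' hr' => hr₀max r' (mem_filter.mpr ⟨mem_univ _, hr'⟩)⟩
  set dist : (Equiv.Perm (Fin m) × (Fin m → Fin K)) → ℤ := fun r =>
    ∑ l, |((univ.filter fun b => r.2 b = l).card : ℤ) - ((univ.filter fun b => q.2 b = l).card : ℤ)| with hdist
  obtain ⟨p, hpS, hpmin⟩ := exists_min_image S dist hSne
  rw [hS, mem_filter] at hpS
  obtain ⟨-, hp, hpmax⟩ := hpS
  refine ⟨p, hp, fun r hr => hpmax r hr, ?_, ?_⟩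
  · -- upper classes: `p` has at most as many as `q`
    intro l hl
    by_contra hcon
    push Not at hcon
    obtain ⟨j, hj, p', q', hp', hq', hcp, hcq, hV⟩ := hex p q hp hq l hcon
    have h1 := sum_class_shift W p.2 p'.2 l j hcp
    have h2 := sum_class_shift W'' q.2 q'.2 j l hcq
    have hq'le : cw W'' q' ≤ cw W'' q := hqmax' q' hq'
    have hWl : W'' l = W l + t := by simp [hW'', hl]
    have hWj : W'' j ≤ W j + t := by simp only [hW'']; split_ifs <;> linarith
    have hp'ge : cw W p ≤ cw W p' := by
      simp only [hcw] at hq'le ⊢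
      linarith
    have hp'S : p' ∈ S := by
      rw [hS, mem_filter]
      exact ⟨mem_univ _, hp', fun r' hr' => (hpmax r' hr').trans hp'ge⟩
    have hd := dist_step (fun l' => (univ.filter fun b => p.2 b = l').card)
      (fun l' => (univ.filter fun b => q.2 b = l').card) (fun l' => (univ.filter fun b => p'.2 b = l').card)
      l j hcp hcon hj
    have hlt : dist p' < dist p := by simp only [hdist]; linarith
    exact absurd (hpmin p' hp'S) (not_le.mpr hlt)
  · -- lower classes: `q` has at most as many as `p`
    intro l hl
    by_contra hcon
    push Not at hcon
    obtain ⟨j, hj, q', p', hq', hp', hcq, hcp, hV⟩ := hex q p hq hp l hcon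
    have h1 := sum_class_shift W p.2 p'.2 j l hcp
    have h2 := sum_class_shift W'' q.2 q'.2 l j hcq
    have hq'le : cw W'' q' ≤ cw W'' q := hqmax' q' hq'
    have hWl : W'' l = W l := by
      simp only [hW'']
      rw [if_neg (not_le.mpr hl), add_zero]
    have hWj : W j ≤ W'' j := by simp only [hW'']; split_ifs <;> linarith
    have hp'ge : cw W p ≤ cw W p' := by
      simp only [hcw] at hq'le ⊢
      linarith
    have hp'S : p' ∈ S := by
      rw [hS, mem_filter]
      exact ⟨mem_univ _, hp', fun r' hr' => (hpmax r' hr').trans hp'ge⟩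
    have hd := dist_step (fun l' => (univ.filter fun b => p.2 b = l').card)
      (fun l' => (univ.filter fun b => q.2 b = l').card) (fun l' => (univ.filter fun b => p'.2 b = l').card)
      j l hcp hj hcon
    have hlt : dist p' < dist p := by simp only [hdist]; linarith
    exact absurd (hpmin p' hp'S) (not_le.mpr hlt)


/-! ## 3. From one stage to the dominance order on class profiles -/

/-- upper class counts are fibre sums of class counts. [folklore] -/
theorem card_upper_eq_sum (f : Fin m → Fin K) (c : ℕ) :
    (univ.filter fun b => c ≤ (f b : ℕ)).card = ∑ l ∈ univ.filter (fun l : Fin K => c ≤ (l : ℕ)),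
      (univ.filter fun b => f b = l).card := by
  rw [card_eq_sum_card_fiberwise (f := f) (t := univ.filter fun l : Fin K => c ≤ (l : ℕ))
    (fun b hb => mem_filter.mpr ⟨mem_univ _, (mem_filter.mp hb).2⟩)]
  refine sum_congr rfl fun l hl => ?_
  congr 1
  ext b
  simp only [mem_filter, mem_univ, true_and]
  constructor
  · exact fun h => h.2
  · intro h; exact ⟨by rw [h]; exact (mem_filter.mp hl).2, h⟩

/-- lower class counts are fibre sums of class counts. [folklore] -/
theorem card_lower_eq_sum (f : Fin m → Fin K) (c : ℕ) :
    (univ.filter fun b => (f b : ℕ) < c).card = ∑ l ∈ univ.filter (fun l : Fin K => (l : ℕ) < c),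
      (univ.filter fun b => f b = l).card := by
  rw [card_eq_sum_card_fiberwise (f := f) (t := univ.filter fun l : Fin K => (l : ℕ) < c)
    (fun b hb => mem_filter.mpr ⟨mem_univ _, (mem_filter.mp hb).2⟩)]
  refine sum_congr rfl fun l hl => ?_
  congr 1
  ext b
  simp only [mem_filter, mem_univ, true_and]
  constructor
  · exact fun h => h.2
  · intro h; exact ⟨by rw [h]; exact (mem_filter.mp hl).2, h⟩

/-- upper and lower counts are complementary. [folklore] -/
theorem card_upper_add_card_lower (f : Fin m → Fin K) (c : ℕ) :
    (univ.filter fun b => c ≤ (f b : ℕ)).card + (univ.filter fun b => (f b : ℕ) < c).card = m := by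
  have h := card_filter_add_card_filter_not (s := (univ : Finset (Fin m))) (fun b => c ≤ (f b : ℕ))
  simp only [not_le, card_univ, Fintype.card_fin] at h
  exact h

/-- the one-stage count relations (`≤` on the classes `≥ c`, `≥` below `c`) imply domination of ALL upper class counts.
[folklore] -/
theorem upper_le_of_stage (f g : Fin m → Fin K) (c : ℕ)
    (hU : ∀ l : Fin K, c ≤ (l : ℕ) → (univ.filter fun b => f b = l).card ≤ (univ.filter fun b => g b = l).card)
    (hL : ∀ l : Fin K, (l : ℕ) < c → (univ.filter fun b => g b = l).card ≤ (univ.filter fun b => f b = l).card)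
    (c' : ℕ) :
    (univ.filter fun b => c' ≤ (f b : ℕ)).card ≤ (univ.filter fun b => c' ≤ (g b : ℕ)).card := by
  rcases le_or_gt c c' with hcc' | hcc'
  · rw [card_upper_eq_sum f c', card_upper_eq_sum g c']
    exact sum_le_sum fun l hl => hU l (hcc'.trans (mem_filter.mp hl).2)
  · have hf := card_upper_add_card_lower f c'
    have hg := card_upper_add_card_lower g c'
    have hlow : (univ.filter fun b => (g b : ℕ) < c').card ≤ (univ.filter fun b => (f b : ℕ) < c').card := by
      rw [card_lower_eq_sum f c', card_lower_eq_sum g c']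
      exact sum_le_sum fun l hl => hL l ((mem_filter.mp hl).2.trans hcc')
    omega

/-- **DOMINANCE MONOTONICITY.**  Under the term-level exchange axiom and monotone exponents, if `p` is the unique optimum at
slope `θ` and `q` the unique optimum at a larger slope `θ'`, then the class profile of `q` DOMINATES that of `p`: for every
threshold `c`, `q` has at least as many columns of class index `≥ c` as `p`.  Proof: write `θ'·d = θ·d + (θ'−θ)·d₀·𝟙 +
Σ_{c ≥ 1} (θ'−θ)(d_c − d_{c−1})·𝟙[· ≥ c]` and descend from `q` through the `K − 1` thresholds with the stage lemma; at the
bottom the `θ·d`-maximiser is `p` itself by uniqueness.  (For designs violating the axiom this fails: SHIFT-THREE's carries.)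
[this file] -/
theorem upper_le_of_dominant (d : Fin K → ℕ) (hd : Monotone d) (v ε : Fin m → Fin m → Fin K → ℤ)
    (hex : ∀ p q : Equiv.Perm (Fin m) × (Fin m → Fin K), termSign ε p ≠ 0 → termSign ε q ≠ 0 →
      ∀ i : Fin K, (univ.filter fun b => q.2 b = i).card < (univ.filter fun b => p.2 b = i).card →
        ∃ j : Fin K, (univ.filter fun b => p.2 b = j).card < (univ.filter fun b => q.2 b = j).card ∧
          ∃ p' q' : Equiv.Perm (Fin m) × (Fin m → Fin K), termSign ε p' ≠ 0 ∧ termSign ε q' ≠ 0 ∧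
            (∀ l, (univ.filter fun b => p'.2 b = l).card + (if l = i then 1 else 0) =
              (univ.filter fun b => p.2 b = l).card + (if l = j then 1 else 0)) ∧
            (∀ l, (univ.filter fun b => q'.2 b = l).card + (if l = j then 1 else 0) =
              (univ.filter fun b => q.2 b = l).card + (if l = i then 1 else 0)) ∧
            (∑ b, v (p'.1 b) b (p'.2 b)) + (∑ b, v (q'.1 b) b (q'.2 b)) ≤
              (∑ b, v (p.1 b) b (p.2 b)) + (∑ b, v (q.1 b) b (q.2 b)))
    {θ θ' : ℤ} (hθ : θ < θ') {p q : Equiv.Perm (Fin m) × (Fin m → Fin K)}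
    (hp : IsDominant d v ε θ p) (hq : IsDominant d v ε θ' q) (c : ℕ) :
    (univ.filter fun b => c ≤ (p.2 b : ℕ)).card ≤ (univ.filter fun b => c ≤ (q.2 b : ℕ)).card := by
  classical
  rcases Nat.eq_zero_or_pos K with hK | hK
  · subst hK
    rcases Nat.eq_zero_or_pos m with hm | hm
    · subst hm; simp
    · exact (p.2 ⟨0, hm⟩).elim0
  -- class-weighted values and the stage weights
  set cw : (Fin K → ℤ) → (Equiv.Perm (Fin m) × (Fin m → Fin K)) → ℤ :=
    fun X r => (∑ b, X (r.2 b)) - ∑ b, v (r.1 b) b (r.2 b) with hcw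
  set Wt : ℕ → Fin K → ℤ := fun s l =>
    θ * d l + (θ' - θ) * ((d ⟨min (l : ℕ) s, lt_of_le_of_lt (Nat.min_le_left _ _) l.isLt⟩ : ℤ) - d ⟨0, hK⟩)
    with hWt
  -- (a) bottom stage: `θ·d`
  have hW0 : ∀ r : Equiv.Perm (Fin m) × (Fin m → Fin K), cw (Wt 0) r = tropWeight d v θ r := by
    intro r
    simp only [hcw, hWt, tropWeight, Nat.min_zero, sub_self, mul_zero, add_zero, mul_sum]
  -- (b) top stage: `θ'·d` up to the constant `(θ'−θ)·d₀` per column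
  have hWtop : ∀ s, K - 1 ≤ s → ∀ r : Equiv.Perm (Fin m) × (Fin m → Fin K),
      cw (Wt s) r = tropWeight d v θ' r - (m : ℤ) * ((θ' - θ) * d ⟨0, hK⟩) := by
    intro s hs r
    have hmin : ∀ l : Fin K, (⟨min (l : ℕ) s, lt_of_le_of_lt (Nat.min_le_left _ _) l.isLt⟩ : Fin K) = l := by
      intro l; apply Fin.ext; simp only; have := l.isLt; omega
    simp only [hcw, hWt, tropWeight, hmin]
    have e : ∀ b, θ * (d (r.2 b) : ℤ) + (θ' - θ) * ((d (r.2 b) : ℤ) - d ⟨0, hK⟩) =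
        θ' * (d (r.2 b) : ℤ) - (θ' - θ) * d ⟨0, hK⟩ := fun b => by ring
    simp only [e, sum_sub_distrib, sum_const, card_univ, Fintype.card_fin, nsmul_eq_mul, mul_sum]
    ring
  -- (c) one step: add `(θ'−θ)(d_{s+1} − d_s) ≥ 0` on the classes `≥ s+1`
  have hWstep : ∀ s (hs : s + 1 < K) (l : Fin K), Wt (s + 1) l =
      Wt s l + (if s + 1 ≤ (l : ℕ) then (θ' - θ) * ((d ⟨s + 1, hs⟩ : ℤ) - d ⟨s, by omega⟩) else 0) := by
    intro s hs l
    simp only [hWt]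
    split_ifs with h
    · have h1 : (⟨min (l : ℕ) (s + 1), lt_of_le_of_lt (Nat.min_le_left _ _) l.isLt⟩ : Fin K) = ⟨s + 1, hs⟩ := by
        apply Fin.ext; simp only; omega
      have h2 : (⟨min (l : ℕ) s, lt_of_le_of_lt (Nat.min_le_left _ _) l.isLt⟩ : Fin K) = ⟨s, by omega⟩ := by
        apply Fin.ext; simp only; omega
      rw [h1, h2]; ring
    · have h1 : (⟨min (l : ℕ) (s + 1), lt_of_le_of_lt (Nat.min_le_left _ _) l.isLt⟩ : Fin K) = l := by
        apply Fin.ext; simp only; omega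
      have h2 : (⟨min (l : ℕ) s, lt_of_le_of_lt (Nat.min_le_left _ _) l.isLt⟩ : Fin K) = l := by
        apply Fin.ext; simp only; omega
      rw [h1, h2]; ring
  -- descent from `q` through the stages
  have key : ∀ n s, s + n = K - 1 → ∃ r : Equiv.Perm (Fin m) × (Fin m → Fin K), termSign ε r ≠ 0 ∧
      (∀ r', termSign ε r' ≠ 0 → cw (Wt s) r' ≤ cw (Wt s) r) ∧
      ∀ c', (univ.filter fun b => c' ≤ (r.2 b : ℕ)).card ≤ (univ.filter fun b => c' ≤ (q.2 b : ℕ)).card := by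
    intro n
    induction n with
    | zero =>
      intro s hs
      refine ⟨q, hq.1, fun r' hr' => ?_, fun c' => le_rfl⟩
      rw [hWtop s (by omega), hWtop s (by omega)]
      by_cases hrq : r' = q
      · rw [hrq]
      · have := hq.2 r' hrq hr'; linarith
    | succ n ih =>
      intro s hs
      obtain ⟨r, hr, hrmax, hrdom⟩ := ih (s + 1) (by omega)
      have hsK : s + 1 < K := by omega
      have ht : 0 ≤ (θ' - θ) * ((d ⟨s + 1, hsK⟩ : ℤ) - d ⟨s, by omega⟩) := by
        apply mul_nonneg (by linarith)
        have : d ⟨s, by omega⟩ ≤ d ⟨s + 1, hsK⟩ := hd (Fin.mk_le_mk.mpr (by omega))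
        have : (d ⟨s, by omega⟩ : ℤ) ≤ d ⟨s + 1, hsK⟩ := by exact_mod_cast this
        linarith
      have hrmax' : ∀ r' : Equiv.Perm (Fin m) × (Fin m → Fin K), termSign ε r' ≠ 0 →
          (∑ b, (Wt s (r'.2 b) + if s + 1 ≤ (r'.2 b : ℕ) then (θ' - θ) * ((d ⟨s + 1, hsK⟩ : ℤ) - d ⟨s, by omega⟩)
            else 0)) - ∑ b, v (r'.1 b) b (r'.2 b) ≤
          (∑ b, (Wt s (r.2 b) + if s + 1 ≤ (r.2 b : ℕ) then (θ' - θ) * ((d ⟨s + 1, hsK⟩ : ℤ) - d ⟨s, by omega⟩)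
            else 0)) - ∑ b, v (r.1 b) b (r.2 b) := by
        intro r' hr'
        have h := hrmax r' hr'
        simp only [hcw, hWstep s hsK] at h
        exact h
      obtain ⟨p₁, hp₁, hp₁max, hU, hL⟩ := stage v ε hex (Wt s) _ ht (s + 1) r hr hrmax'
      refine ⟨p₁, hp₁, fun r' hr' => ?_, fun c' => (upper_le_of_stage p₁.2 r.2 (s + 1) hU hL c').trans (hrdom c')⟩
      have := hp₁max r' hr'
      simpa only [hcw] using this
  obtain ⟨r, hr, hrmax, hrdom⟩ := key (K - 1) 0 (by omega)
  -- at the bottom the maximiser is `p`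
  have hrp : r = p := by
    by_contra hne
    have h1 := hp.2 r hne hr
    have h2 := hrmax p hp.1
    rw [hW0, hW0] at h2
    linarith
  rw [← hrp]
  exact hrdom c

end Summit.ValiantsHypothesis.ValiantsHypothesis.Theorems.KPlusLogSqLaw.ExchangeSector
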